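import Literature.MathematicalPhysics.QuantumFieldTheory.Balaban1983to89.B11Ineq189
import Literature.MathematicalPhysics.QuantumFieldTheory.Balaban1983to89.B11SupSize190

/-!
# `Balaban1983to89.B11Ineq189HasMaj2Kernel` — T. Bałaban, *The variational problem and background fields in renormalization group method for
# lattice gauge theories*, Commun. Math. Phys. **102** (1985) 277–309 [Balaban1985Variational], (189) p. 308: THE DICTIONARY FROM ENTRYWISE
# BILINEAR KERNEL BOUNDS TO THE BLOCK MAJORANT `HasMaj₂` of the (189) term census — *«(size of T[𝔄]μ near y) ≤ K(y, y″, y′)·(size of μ at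
# y″)·(size of 𝔄 at y′), for supp 𝔄 ⊂ Δ̃(y′), supp μ ⊂ Δ(y″)»* — between the concrete sup sizes of `B11SupSize190`

statement-level skeleton of published theorems with citation tags; proofs where landed; nothing here is a claim about the Yang–Mills mass gap

PDF held: `paper:balaban1985-cmp102-variational-background` (journal page = PDF page + 276), p. 308 [PDF 32]: *«for supp 𝔄 ⊂ Δ̃(y′) … y ∈ Λ_j»*
in (189); and [3] T. Bałaban, *Propagators and renormalization transformations II*, CMP **96** (1984) [Balaban1984PropagatorsII], (2.64)–(2.66)
p. 235 (kernel bounds ⇒ weighted operator bounds).  Displays in the transcriptions of record of `B11Ineq189` / `B11Ineq73HasMajConcrete`.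

CITATION HEADER (lean-in-tree rule 2026-08-18).  WHAT IS REPRODUCED: SKELETON row **B11.Eq189** (GAPS G-B11-G2; cell census
`SECOND-DERIVATIVE-189.md` §§4–5: every term of (δ²/δA′²)V is a chain of fixed decaying operators around a LOCAL bilinear leaf; the leaf enters
`B11Ineq189.hasMaj₂_local` through `hloc : size_y(T v μ) ≤ β·size_y(μ)·size_y(v)` and the chains through `HasMaj₂.precomp/postcomp`).  The
linear dictionary of record is `B11Ineq73HasMajConcrete.hasMaj_supSize_of_kernel` (*«KERNEL BOUNDS ⇒ MAJORANT»* for `HasMaj` between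
`supSize` block norms, consumed by the (73)/(190) chain).  THIS FILE is its BILINEAR twin: entrywise bounds `‖T(e_a v)(e_b w)(c)‖ ≤
κ(c, a, b)‖v‖‖w‖` (what the two-variable Cauchy leaves `B11Ineq189LeafCk` / `B11Ineq189LeafCkLocal` deliver for Bałaban's C_k, entry by entry)
plus joint block row sums `Σ_{a ∈ block y′} Σ_{b ∈ block y″} κ(c, a, b) ≤ K(y, y″, y′)` for `c` in the box of `y` ⟹ `HasMaj₂ … T K`.

WHAT IS CERTIFIED (kernel, sorry-free; standard axioms; theorems only): private `apply_eq_sum_single₂` (bilinear decomposition along the fine points),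
**`hasMaj₂_supSize_of_kernel`** (the dictionary), `hasMaj₂_supSize_of_local_kernel` (the LOCAL special case: κ(c, a, b) ≤ β when the blocks
of a and b both equal the block of c's box point and 0 otherwise ⟹ the majorant `β·N_A·N₁·𝟙[y″ = y]·𝟙[y′ = y]` with `N` the block
cardinality bounds — the shape `hasMaj₂_local` starts from, with identity localities).

HONEST SCOPE.  Pure bookkeeping over finite index sets and real normed value spaces; no lattice object is asserted; the entry bounds and the
row sums are hypotheses (supplied, for C_k, by the leaves and by counting bonds in a box).  Seat pub-ymgap-dag-n07-b (HUMAN RULING D-0062,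
node N07 [B11]; the bridge from this seat's leaves to the assembly seat's `HasMaj₂` currency).  Imports `B11Ineq189`, `B11SupSize190`; no
definition, no new named fact.
-/

noncomputable section

open scoped BigOperators
open Finset

namespace Literature.MathematicalPhysics.QuantumFieldTheory.Balaban1983to89.B11Ineq189HasMaj2Kernel

open Literature.MathematicalPhysics.QuantumFieldTheory.Balaban1983to89
open B11SectG B11SupSize190 B11Ineq189

variable {g : B6.Geometry} [DecidableEq g.Site] {XA X₁ X₂ : Type} [Fintype XA] [DecidableEq XA] [Fintype X₁] [DecidableEq X₁]
  {EA E₁ E₂ : Type} [NormedAddCommGroup EA] [NormedSpace ℝ EA] [NormedAddCommGroup E₁] [NormedSpace ℝ E₁]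
  [NormedAddCommGroup E₂] [NormedSpace ℝ E₂]

/-! ## §1 Bilinear decomposition along the fine points -/

/-- A bilinear family evaluated on two finitely-indexed fields decomposes along the coordinate insertions:
`T v μ = Σ_a Σ_b T(e_a v_a)(e_b μ_b)`. [folklore] -/
private theorem apply_eq_sum_single₂ (T : (XA → EA) →ₗ[ℝ] (X₁ → E₁) →ₗ[ℝ] (X₂ → E₂)) (v : XA → EA) (μ : X₁ → E₁) :
    T v μ = ∑ a, ∑ b, T (Pi.single a (v a)) (Pi.single b (μ b)) := by
  conv_lhs => rw [← Finset.univ_sum_single v, map_sum, LinearMap.coe_sum, Finset.sum_apply]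
  refine Finset.sum_congr rfl fun a _ => ?_
  conv_lhs => rw [← Finset.univ_sum_single μ, map_sum]

/-! ## §2 Entrywise kernel bounds + joint block row sums ⇒ `HasMaj₂` -/

/-- **BILINEAR KERNEL BOUNDS ⇒ MAJORANT** (the (189) reading *«for supp 𝔄 ⊂ Δ̃(y′), supp μ ⊂ Δ(y″): size near y ≤ K(y, y″, y′)·|μ|·|𝔄|»*):
if `‖T(e_a v)(e_b w)(c)‖ ≤ κ(c, a, b)‖v‖‖w‖` for all fine points `a`, `b`, values `v`, `w` and coarse points `c`, every fine point lies in the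
box of its block, and `Σ_{a : blk a = y′} Σ_{b : blk b = y″} κ(c, a, b) ≤ K(y, y″, y′)` for `c` in the box of `y`, then `T` has the majorant `K`
between the sup sizes. [cite: Balaban1985Variational, (189) p.308] [cite: Balaban1984PropagatorsII, (2.64)–(2.66) p.235] -/
theorem hasMaj₂_supSize_of_kernel (boxA : g.Site → Finset XA) (blkA : XA → g.Site) (box₁ : g.Site → Finset X₁) (blk₁ : X₁ → g.Site)
    (box₂ : g.Site → Finset X₂) (blk₂ : X₂ → g.Site) (hboxA : ∀ a, a ∈ boxA (blkA a)) (hbox₁ : ∀ b, b ∈ box₁ (blk₁ b))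
    (T : (XA → EA) →ₗ[ℝ] (X₁ → E₁) →ₗ[ℝ] (X₂ → E₂)) (κ : X₂ → XA → X₁ → ℝ) (hκ : ∀ c a b, 0 ≤ κ c a b)
    (hT : ∀ (a : XA) (v : EA) (b : X₁) (w : E₁) (c : X₂), ‖T (Pi.single a v) (Pi.single b w) c‖ ≤ κ c a b * ‖v‖ * ‖w‖)
    (K : g.Site → g.Site → g.Site → ℝ) (hK0 : ∀ y y'' y', 0 ≤ K y y'' y')
    (hK : ∀ (y y'' y' : g.Site), ∀ c ∈ box₂ y,
      ∑ a ∈ univ.filter (fun a => blkA a = y'), ∑ b ∈ univ.filter (fun b => blk₁ b = y''), κ c a b ≤ K y y'' y') :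
    HasMaj₂ (supSize g boxA blkA : BlockNorm g (XA → EA)) (supSize g box₁ blk₁ : BlockNorm g (X₁ → E₁))
      (supSize g box₂ blk₂ : BlockNorm g (X₂ → E₂)) T K := by
  intro y' v hv y'' μ hμ y
  have hv' : ∀ a, blkA a ≠ y' → v a = 0 := (supSize_isLoc_iff y' v).1 hv
  have hμ' : ∀ b, blk₁ b ≠ y'' → μ b = 0 := (supSize_isLoc_iff y'' μ).1 hμ
  set ℓA := (supSize g boxA blkA : BlockNorm g (XA → EA)).loc y' v with hℓA_def
  set ℓ₁ := (supSize g box₁ blk₁ : BlockNorm g (X₁ → E₁)).loc y'' μ with hℓ₁_def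
  have hℓA0 : 0 ≤ ℓA := (supSize g boxA blkA : BlockNorm g (XA → EA)).loc_nonneg y' v
  have hℓ₁0 : 0 ≤ ℓ₁ := (supSize g box₁ blk₁ : BlockNorm g (X₁ → E₁)).loc_nonneg y'' μ
  have hva : ∀ a, ‖v a‖ ≤ (if blkA a = y' then ℓA else 0) := by
    intro a
    by_cases ha : blkA a = y'
    · rw [if_pos ha, hℓA_def, ← ha]
      exact norm_apply_le_loc (hboxA a) v
    · rw [if_neg ha, hv' a ha, norm_zero]
  have hμb : ∀ b, ‖μ b‖ ≤ (if blk₁ b = y'' then ℓ₁ else 0) := by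
    intro b
    by_cases hb : blk₁ b = y''
    · rw [if_pos hb, hℓ₁_def, ← hb]
      exact norm_apply_le_loc (hbox₁ b) μ
    · rw [if_neg hb, hμ' b hb, norm_zero]
  refine loc_le_of_forall (mul_nonneg (mul_nonneg (hK0 y y'' y') hℓ₁0) hℓA0) fun c hc => ?_
  calc ‖T v μ c‖ = ‖∑ a, ∑ b, T (Pi.single a (v a)) (Pi.single b (μ b)) c‖ := by
          rw [apply_eq_sum_single₂ T v μ]
          simp only [Finset.sum_apply]
    _ ≤ ∑ a, ∑ b, ‖T (Pi.single a (v a)) (Pi.single b (μ b)) c‖ :=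
        (norm_sum_le _ _).trans (Finset.sum_le_sum fun a _ => norm_sum_le _ _)
    _ ≤ ∑ a, ∑ b, κ c a b * (if blkA a = y' then ℓA else 0) * (if blk₁ b = y'' then ℓ₁ else 0) :=
        Finset.sum_le_sum fun a _ => Finset.sum_le_sum fun b _ =>
          (hT a (v a) b (μ b) c).trans
            (mul_le_mul (mul_le_mul_of_nonneg_left (hva a) (hκ c a b)) (hμb b) (norm_nonneg _)
              (mul_nonneg (hκ c a b) (by split_ifs <;> [exact hℓA0; exact le_rfl])))
    _ = ∑ a ∈ univ.filter (fun a => blkA a = y'), ∑ b ∈ univ.filter (fun b => blk₁ b = y''), κ c a b * ℓA * ℓ₁ := by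
        rw [Finset.sum_filter]
        refine Finset.sum_congr rfl fun a _ => ?_
        rw [Finset.sum_filter]
        split_ifs with ha
        · refine Finset.sum_congr rfl fun b _ => ?_
          split_ifs <;> simp
        · simp
    _ = (∑ a ∈ univ.filter (fun a => blkA a = y'), ∑ b ∈ univ.filter (fun b => blk₁ b = y''), κ c a b) * ℓ₁ * ℓA := by
        rw [Finset.sum_mul, Finset.sum_mul]
        refine Finset.sum_congr rfl fun a _ => ?_
        rw [Finset.sum_mul, Finset.sum_mul]
        refine Finset.sum_congr rfl fun b _ => ?_
        ring
    _ ≤ K y y'' y' * ℓ₁ * ℓA :=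
        mul_le_mul_of_nonneg_right (mul_le_mul_of_nonneg_right (hK y y'' y' c hc) hℓ₁0) hℓA0

/-! ## §3 The local special case: entries supported on one block -/

/-- **THE LOCAL BILINEAR LEAF FROM LOCAL ENTRY BOUNDS**: if the entry `κ(c, a, b)` is `≤ β` when BOTH fine points lie in the block of the box
point of `c` (`blkA a = y`, `blk₁ b = y` for `c ∈ box₂ y`) and VANISHES otherwise, and the blocks have at most `NA`, `N₁` fine points, then `T`
has the majorant `β·NA·N₁·𝟙[y″ = y]·𝟙[y′ = y]` — the purely local kernel (no decay letters needed) that `B11Ineq189.hasMaj₂_local` dresses with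
the identity localities. [cite: Balaban1985Variational, (189) p.308] -/
theorem hasMaj₂_supSize_of_local_kernel (boxA : g.Site → Finset XA) (blkA : XA → g.Site)
    (box₁ : g.Site → Finset X₁) (blk₁ : X₁ → g.Site) (box₂ : g.Site → Finset X₂) (blk₂ : X₂ → g.Site)
    (hboxA : ∀ a, a ∈ boxA (blkA a)) (hbox₁ : ∀ b, b ∈ box₁ (blk₁ b))
    (T : (XA → EA) →ₗ[ℝ] (X₁ → E₁) →ₗ[ℝ] (X₂ → E₂)) (κ : X₂ → XA → X₁ → ℝ) (hκ : ∀ c a b, 0 ≤ κ c a b) {β : ℝ} (hβ : 0 ≤ β)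
    (hT : ∀ (a : XA) (v : EA) (b : X₁) (w : E₁) (c : X₂), ‖T (Pi.single a v) (Pi.single b w) c‖ ≤ κ c a b * ‖v‖ * ‖w‖)
    (hloc : ∀ (y : g.Site), ∀ c ∈ box₂ y, ∀ a b, κ c a b ≤ (if blkA a = y ∧ blk₁ b = y then β else 0))
    {NA N₁ : ℕ} (hNA : ∀ y, (univ.filter fun a => blkA a = y).card ≤ NA) (hN₁ : ∀ y, (univ.filter fun b => blk₁ b = y).card ≤ N₁) :
    HasMaj₂ (supSize g boxA blkA : BlockNorm g (XA → EA)) (supSize g box₁ blk₁ : BlockNorm g (X₁ → E₁))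
      (supSize g box₂ blk₂ : BlockNorm g (X₂ → E₂)) T
      (fun y y'' y' => β * NA * N₁ * (if y'' = y then 1 else 0) * (if y' = y then 1 else 0)) := by
  refine hasMaj₂_supSize_of_kernel boxA blkA box₁ blk₁ box₂ blk₂ hboxA hbox₁ T κ hκ hT _ (fun y y'' y' => ?_) (fun y y'' y' c hc => ?_)
  · have : (0 : ℝ) ≤ NA := Nat.cast_nonneg _
    have : (0 : ℝ) ≤ N₁ := Nat.cast_nonneg _
    split_ifs <;> positivity
  · by_cases hy : y'' = y ∧ y' = y
    · obtain ⟨h1, h2⟩ := hy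
      rw [if_pos h1, if_pos h2]
      calc ∑ a ∈ univ.filter (fun a => blkA a = y'), ∑ b ∈ univ.filter (fun b => blk₁ b = y''), κ c a b
          ≤ ∑ a ∈ univ.filter (fun a => blkA a = y'), ∑ b ∈ univ.filter (fun b => blk₁ b = y''), β :=
            Finset.sum_le_sum fun a _ => Finset.sum_le_sum fun b _ => (hloc y c hc a b).trans (by split_ifs <;> linarith)
        _ = (univ.filter (fun a => blkA a = y')).card * ((univ.filter (fun b => blk₁ b = y'')).card * β) := by
            rw [Finset.sum_const, nsmul_eq_mul, Finset.sum_const, nsmul_eq_mul]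
        _ ≤ NA * (N₁ * β) := by
            have e1 : ((univ.filter (fun a => blkA a = y')).card : ℝ) ≤ NA := by exact_mod_cast hNA y'
            have e2 : ((univ.filter (fun b => blk₁ b = y'')).card : ℝ) ≤ N₁ := by exact_mod_cast hN₁ y''
            have e3 : (0 : ℝ) ≤ N₁ * β := mul_nonneg (Nat.cast_nonneg _) hβ
            calc ((univ.filter (fun a => blkA a = y')).card : ℝ) * ((univ.filter (fun b => blk₁ b = y'')).card * β)
                ≤ ((univ.filter (fun a => blkA a = y')).card : ℝ) * (N₁ * β) :=
                  mul_le_mul_of_nonneg_left (mul_le_mul_of_nonneg_right e2 hβ) (Nat.cast_nonneg _)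
              _ ≤ NA * (N₁ * β) := mul_le_mul_of_nonneg_right e1 e3
        _ = β * NA * N₁ * 1 * 1 := by ring
    · -- off the diagonal every entry vanishes
      have hzero : ∑ a ∈ univ.filter (fun a => blkA a = y'), ∑ b ∈ univ.filter (fun b => blk₁ b = y''), κ c a b ≤ 0 := by
        refine Finset.sum_nonpos fun a ha => Finset.sum_nonpos fun b hb => ?_
        rw [Finset.mem_filter] at ha hb
        have h := hloc y c hc a b
        have hne : ¬ (blkA a = y ∧ blk₁ b = y) := by
          rintro ⟨h1, h2⟩
          exact hy ⟨hb.2.symm.trans h2, ha.2.symm.trans h1⟩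
        rw [if_neg hne] at h
        exact h
      refine hzero.trans ?_
      have : (0 : ℝ) ≤ NA := Nat.cast_nonneg _
      have : (0 : ℝ) ≤ N₁ := Nat.cast_nonneg _
      split_ifs <;> positivity

end Literature.MathematicalPhysics.QuantumFieldTheory.Balaban1983to89.B11Ineq189HasMaj2Kernel

end
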